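import Mathlib
import HarnessLib
import Summits.HubbardSuperconductivity.HubbardSuperconductivity.Theorems.KLProgrammeKLRegimeTwoVolumeLipDefectStep
import Summits.HubbardSuperconductivity.HubbardSuperconductivity.Theorems.KLProgrammeKLRegimeTwoVolumeLipSrcDoorKit
import Summits.HubbardSuperconductivity.HubbardSuperconductivity.Theorems.KLProgrammeKLRegimeTwoVolumeLipDoorKit

/-!
# Route `KLProgramme` — crux K3 ENGINE (stmt-HubbardSuperconductivity-20437), stub (e) proof-input «(e)-D-ROWS», F-D5c′ (iv): THE COVARIANCE-DEFECT SOURCE OF BLOCK `k`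
# AT A DEEP PIN WITH ITS NEAR BRACKET IN KIT FORM
# (seat hubbard-kl-k3c4-p1 g24; `--supports` 20437; DROWS-SCOPE-g24 v10 §12.2 N7 / §12.4)

`…TwoVolumeLipDefectStep.lipSourceDefect_le` (p706740) bounds the source defect of block `k` at an `(R+R_f)`-deep pin by a NEAR bracket in door form plus a FAR bracket.
Here the near bracket is replaced by its KIT image (`…TwoVolumeLipSrcDoorKit.srcNearDoor_le_kit`), the door's near smallness `θ_n < 1` being DERIVED from the kit's
guard (`…TwoVolumeLipDoorKit.door_theta_lt_one_of_guard` at `α := 2T`); output degree `n + 1 = 2·ph`.  The result is the `hstep` shape of g22's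
`…TwoVolumeLipSourceLaw.src_le_law` (near part; `σₑ := T`, `σₙ := κ_n²`, `Φ := e(2T)/κ_n²`, `ψ := ρ_n⁻²`, `τ := (e²(κ_n+ρ_n))²`, `N := N₀−1`) plus the far bracket
verbatim (→ `…TwoVolumeLipFarHalfDegree` → `farSrc_le_law`), i.e. the `Es` profile of the (Db) row one step before its law reading.

* **`lipSourceDefect_le_kit`** — p706740's binders with `hθn` replaced by (`Nn 0 = 0`, `D ≥ |Γ_k|/2`, `n+1 = 2ph`, the kit guard).

A composition of landed theorems; nothing asserts the (D) rows, stub (e), VL, K3 or superconductivity.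
References: BGM 2006 (2.13)–(2.14), (2.77)–(2.90), §3 [cite: BenfattoGiulianiMastropietro2006]; Salmhofer 1998 §3.1, §4.1.
-/

noncomputable section

namespace Summit.HubbardSuperconductivity.HubbardSuperconductivity.Theorems.TwoVolumeLip

set_option linter.dupNamespace false -- summit = problem name (single-conjunct summit), D-0017

open Finset Literature.MathematicalPhysics.QuantumLattice GrassmannAlgebra Literature.Probability.LatticeModels
open Literature.MathematicalPhysics.QuantumLattice.FermiRG
open Summit.HubbardSuperconductivity.HubbardSuperconductivity.Theorems.KLRegimeSplit
open Summit.HubbardSuperconductivity.HubbardSuperconductivity.Theorems.KLProgrammeLegKernels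
open Summit.HubbardSuperconductivity.HubbardSuperconductivity.Theorems.DispersionFlow
open Summit.HubbardSuperconductivity.HubbardSuperconductivity.Theorems.EngineV8
open Summit.HubbardSuperconductivity.HubbardSuperconductivity.Theorems.TwoVolumeSource
open Summit.HubbardSuperconductivity.HubbardSuperconductivity.Theorems.TwoVolumeDefect

variable {L b M : ℕ} [NeZero L] [NeZero (b * L)] [NeZero M]

set_option maxHeartbeats 400000 in -- large statement
/-- **The covariance-defect source of block `k` at a deep pin, near bracket in kit form** (see the module docstring; binders of `lipSourceDefect_le`). -/
theorem lipSourceDefect_le_kit {d k : ℕ} [LinearOrder (SpaceTimeIdx (b * L) M × SectorLeg (sectorCount (d * k - 1)))]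
    {E : Type*} [NormedAddCommGroup E] [InnerProductSpace ℂ E] {β : ℝ} (hβ : β ≠ 0) (U μ : ℝ) (K : TrigPolyC4v) (hdk : 1 ≤ d * k) (R Rf : ℕ)
    (hZc : hubbardEffPartitionFnCT L M β U μ 0 K (klScale klE0 (d * k)) ≠ 0)
    (hZc' : hubbardEffPartitionFnCT L M β U μ 0 K (klScale klE0 (d * (k + 1))) ≠ 0)
    -- FAR piece: charged Gram form (block constants), sups and rows of the two block covariances
    (q : SpaceTimeIdx (b * L) M × SectorLeg (sectorCount (d * k - 1)) → Bool)
    (hq : ∀ X Y, q X = q Y → klLipDefectFar L b M β μ K d k R X Y = 0) (f g : SpaceTimeIdx (b * L) M × SectorLeg (sectorCount (d * k - 1)) → E)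
    {κf : ℝ} (hκf : 0 < κf) (hf : ∀ X, q X = true → ‖f X‖ ≤ κf) (hg : ∀ Y, q Y = false → ‖g Y‖ ≤ κf)
    (hG : ∀ X Y, q X = true → q Y = false → contr ℂ (klLipDefectFar L b M β μ K d k R) X Y = inner ℂ (f X) (g Y))
    {s' s : ℝ} (hs'0 : 0 ≤ s') (hs0 : 0 ≤ s) (hs' : ∀ X' Y', ‖klLipCov (b * L) M β μ K d k X' Y'‖ ≤ s') (hs : ∀ X Y, ‖klLipCov L M β μ K d k X Y‖ ≤ s)
    {α' α : ℝ} (hαpos : 0 < α' + α)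
    (hrow' : ∀ X', ∑ Y', ‖klLipCov (b * L) M β μ K d k X' Y'‖ ≤ α') (hrow : ∀ X, ∑ Y, ‖klLipCov L M β μ K d k X Y‖ ≤ α)
    (hcol' : ∀ Y', ∑ X', ‖klLipCov (b * L) M β μ K d k X' Y'‖ ≤ α') (hcol : ∀ Y, ∑ X, ‖klLipCov L M β μ K d k X Y‖ ≤ α)
    -- the pin
    (w : SpaceTimeIdx (b * L) M × SectorLeg (sectorCount (d * k - 1))) (hw : w ∈ klDeepPins L (R + Rf))
    -- profile of the coarse block output (unweighted, every residue pin) and the far smallness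
    (Nf : ℕ → ℝ) (hNf0 : ∀ m', 0 ≤ Nf m')
    (hNf : ∀ m' (j : Fin (2 * m')) (y : SpaceTimeIdx L M × SectorLeg (sectorCount (d * k - 1))),
      ∑ Y ∈ univ.filter (fun Y : Fin (2 * m') → SpaceTimeIdx L M × SectorLeg (sectorCount (d * k - 1)) => Y j = y),
        ‖kernel ℂ (effAction ℂ (klLipCov L M β μ K d k) (klLipInput L M β U μ K d k)) (2 * m') Y‖ ≤ Nf m')
    {ρf : ℝ} (hρf : 0 < ρf)
    (hθf : Real.exp 1 * (α' + α) * normV (SpaceTimeIdx (b * L) M × SectorLeg (sectorCount (d * k - 1))) κf ρf Nf / κf ^ 2 < 1)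
    -- uniform-in-`s` data of the Polchinski path `effAction (s • D_f) W`
    (nV mV mL : ℕ → ℝ) (hnV : ∀ m, 0 ≤ nV m) (hmV : ∀ m, 0 ≤ mV m)
    (hVs0 : ∀ sP ∈ Set.Icc (0 : ℝ) 1, ∀ (m : ℕ) (x : SpaceTimeIdx (b * L) M × SectorLeg (sectorCount (d * k - 1))),
      ∑ Ut ∈ univ.filter (fun Ut : Fin (m + 1) → SpaceTimeIdx (b * L) M × SectorLeg (sectorCount (d * k - 1)) => Ut 0 = x),
        ‖kernel ℂ (effAction ℂ (sP • klLipDefectFar L b M β μ K d k R)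
          (effAction ℂ (klCopiesCov L b M (sectorCount (d * k - 1)) (klLipCov L M β μ K d k))
            (klGlue L b M (sectorCount (d * k - 1)) (klLipInput L M β U μ K d k)))) (m + 1) Ut‖ ≤ nV (m + 1))
    (hVsm : ∀ sP ∈ Set.Icc (0 : ℝ) 1, ∀ (m : ℕ) (i : Fin m),
      ∑ Ut ∈ univ.filter (fun Ut : Fin (m + 1) → SpaceTimeIdx (b * L) M × SectorLeg (sectorCount (d * k - 1)) => Ut i.succ = w),
        (Torus.tnorm ((Ut 0).1.2 - w.1.2) : ℝ) * ‖kernel ℂ (effAction ℂ (sP • klLipDefectFar L b M β μ K d k R)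
          (effAction ℂ (klCopiesCov L b M (sectorCount (d * k - 1)) (klLipCov L M β μ K d k))
            (klGlue L b M (sectorCount (d * k - 1)) (klLipInput L M β U μ K d k)))) (m + 1) Ut‖ ≤ mV (m + 1))
    (n : ℕ) (p : Fin (n + 1))
    (hVsL : ∀ sP ∈ Set.Icc (0 : ℝ) 1,
      ∑ Z ∈ univ.filter (fun Z : Fin (n + 1 + 1 + 1) → SpaceTimeIdx (b * L) M × SectorLeg (sectorCount (d * k - 1)) =>
          Z (Fin.castSucc (Fin.castSucc p)) = w),
        (Torus.tnorm ((Z (Fin.last (n + 1 + 1))).1.2 - w.1.2) : ℝ) * ‖kernel ℂ (effAction ℂ (sP • klLipDefectFar L b M β μ K d k R)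
          (effAction ℂ (klCopiesCov L b M (sectorCount (d * k - 1)) (klLipCov L M β μ K d k))
            (klGlue L b M (sectorCount (d * k - 1)) (klLipInput L M β U μ K d k)))) (n + 1 + 2) Z‖ ≤ mL (n + 3))
    -- NEAR piece: Gram constant (block constant), far row tail of the fine block covariance, profile of `W₁`, smallness, truncation
    {κn : ℝ} (hκn : 0 < κn) (hGBn : IsGramBoundedR (klLipDefectNear L b M β μ K d k R) κn)
    {T : ℝ} (hT0 : 0 < T)
    (hT : ∀ X' : SpaceTimeIdx (b * L) M × SectorLeg (sectorCount (d * k - 1)),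
      ∑ Y' ∈ univ.filter (fun Y' : SpaceTimeIdx (b * L) M × SectorLeg (sectorCount (d * k - 1)) => R < Torus.tnorm (X'.1.2 - Y'.1.2)),
        ‖klLipCov (b * L) M β μ K d k X' Y'‖ ≤ T)
    (Nn : ℕ → ℝ) (hNn0 : ∀ m', 0 ≤ Nn m')
    (hNn : ∀ (m' : ℕ) (j : Fin (2 * m')) (x : SpaceTimeIdx (b * L) M × SectorLeg (sectorCount (d * k - 1))),
      ∑ Z ∈ univ.filter (fun Z : Fin (2 * m') → SpaceTimeIdx (b * L) M × SectorLeg (sectorCount (d * k - 1)) => Z j = x),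
        ‖kernel ℂ (effAction ℂ (klLipDefectFar L b M β μ K d k R)
          (effAction ℂ (klCopiesCov L b M (sectorCount (d * k - 1)) (klLipCov L M β μ K d k))
            (klGlue L b M (sectorCount (d * k - 1)) (klLipInput L M β U μ K d k)))) (2 * m') Z‖ ≤ Nn m')
    {ρn : ℝ} (hρn : 0 < ρn)
    (hNn00 : Nn 0 = 0) {D : ℕ} (hD : Fintype.card (SpaceTimeIdx (b * L) M × SectorLeg (sectorCount (d * k - 1))) / 2 ≤ D) {ph : ℕ} (hnp : n + 1 = 2 * ph)
    (hguard : Real.exp 1 * (2 * T) / κn ^ 2 * towerV D ((Real.exp 2 * (κn + ρn)) ^ 2) Nn < 1)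
    {N₀ : ℕ} (hN₀ : 2 ≤ N₀) :
    ∑ X ∈ univ.filter (fun X : Fin (n + 1) → SpaceTimeIdx (b * L) M × SectorLeg (sectorCount (d * k - 1)) => X p = w),
        ‖kernel ℂ (effAction ℂ (klCopiesCov L b M (sectorCount (d * k - 1)) (klLipCov L M β μ K d k) + klLipDefectNear L b M β μ K d k R +
              klLipDefectFar L b M β μ K d k R) (klGlue L b M (sectorCount (d * k - 1)) (klLipInput L M β U μ K d k))) (n + 1) X -
          kernel ℂ (effAction ℂ (klCopiesCov L b M (sectorCount (d * k - 1)) (klLipCov L M β μ K d k))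
            (klGlue L b M (sectorCount (d * k - 1)) (klLipInput L M β U μ K d k))) (n + 1) X‖ ≤
      ((((ph + 1) * (2 * ph + 1) : ℕ) : ℝ) * T * (Nn (ph + 1) + towerFO D (κn ^ 2) Nn (ph + 1)) +
        (∑ n' ∈ Icc 2 (N₀ - 1), Real.exp 1 * (Real.exp 1 * (2 * T) / κn ^ 2) ^ (n' - 1) * (ρn⁻¹ ^ 2) ^ ph * towerS D ((Real.exp 2 * (κn + ρn)) ^ 2) Nn n' ph +
          (ρn⁻¹ ^ 2) ^ ph * (Real.exp 1 * towerV D ((Real.exp 2 * (κn + ρn)) ^ 2) Nn * ((Real.exp 1 * (2 * T) / κn ^ 2) * towerV D ((Real.exp 2 * (κn + ρn)) ^ 2) Nn) ^ (N₀ - 1) /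
            (1 - (Real.exp 1 * (2 * T) / κn ^ 2) * towerV D ((Real.exp 2 * (κn + ρn)) ^ 2) Nn)))) +
        ((((n + 1 + 1) * (n + 1 + 2) : ℕ) : ℝ) / 2 * ((s' + s) / ((Rf : ℝ) + 1)) * mL (n + 3) +
          ‖(2 : ℂ)⁻¹‖ * ∑ a ∈ range (n + 2), ∑ b' ∈ range (n + 2),
            (if a + b' = n + 1 then (((a + 1) * (b' + 1) : ℕ) : ℝ) *
              ((α' + α) * (mV (a + 1) / ((Rf : ℝ) + 1)) * nV (b' + 1) + (α' + α) * nV (a + 1) * (mV (b' + 1) / ((Rf : ℝ) + 1))) else 0)) := by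
  have hθn := door_theta_lt_one_of_guard (Γ := SpaceTimeIdx (b * L) M × SectorLeg (sectorCount (d * k - 1))) hκn hρn (by positivity : (0 : ℝ) ≤ 2 * T) hNn0 hNn00 hD hguard
  exact (lipSourceDefect_le hβ U μ K hdk R Rf hZc hZc' q hq f g hκf hf hg hG hs'0 hs0 hs' hs hαpos hrow' hrow hcol' hcol w hw Nf hNf0 hNf hρf hθf nV mV mL
      hnV hmV hVs0 hVsm n p hVsL hκn hGBn hT0 hT Nn hNn0 hNn hρn hθn hN₀).trans
    (add_le_add (srcNearDoor_le_kit hκn hρn hT0.le hNn0 hNn00 hD hN₀ hnp hguard) le_rfl)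

end Summit.HubbardSuperconductivity.HubbardSuperconductivity.Theorems.TwoVolumeLip

end
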